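import Mathlib
import HarnessLib
import Summits.Ventures.LatticeQCDFlow.Exactness.KickedProductTrajectory

/-!
# Multi-step leapfrog with a multiplicative drift: the `n`-step product is a Lipschitz-small perturbation of `p ↦ W_n(0) + nδ·J p` on the momentum ball (discrete Grönwall with bilinear defect)

HONEST FRAMING: exact (Metropolis-corrected) sampling algorithms for lattice gauge theory;
figures of merit are autocorrelation/cost numbers at stated couplings and volumes; no
continuum-physics claim.

Venture `LatticeQCDFlow` (cell pub-lqcd), topic `Exactness`, FANOUT row 9 (eng-latcore, the
engine `latflow.core.hmc.HMC(f, β, 'leapfrog').trajectory(τ, nstep)` / `sun_2d.HMC2D` on `SU(N)`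
with `nstep ≥ 2`).  NEW WORK of the cell over Mathlib and the tree's `KickedProductTrajectory.lean`
(`plfTraj`, `PLFBounds`, the one-trajectory bounds); nothing here is cited as a fact.  Printed
counterparts, NAMED ONLY: Duane–Kennedy–Pendleton–Roweth 1987; Bou-Rabee–Sanz-Serna 2018
(irreducibility of HMC for short trajectories); Mackenzie 1989 (long trajectories: nothing asserted).

THE ESTIMATE.  Two trajectories `(W_k, m_k)`, `(W'_k, m'_k)` of `plfTraj ex J G δ` from `(1, p)`,
`(1, p')` with `‖p‖, ‖p'‖ ≤ R`; `θ = δ‖J‖(R + (2n+1)b)` bounds every drift argument, `Θ = nθ` the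
total angle, `κ‖J‖ = Kδn²‖J‖`.  One step of the difference is EXACTLY
`eW − e'W' − (x+y) = (W − W' − x) + (e' − 1)(W − W') + (e − e' − d)W + d(W − 1) + (d − y)`
(`plf_step_identity`), whose five terms are bounded by `2θ‖ΔW‖`, `η‖Δa‖C`, `‖Δa‖·2ΘC`, `δ‖J‖‖Δm − Δp‖`
— bilinear in (small angle) × (difference), so the induction closes UNIFORMLY IN `n`:

* `plfSmall J C K η δ b R n = 6Θ(1 + 2C) + 6ηC + 12κ‖J‖` (the smallness number), `plfRate = δ‖J‖·plfSmall/3`;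
* **`plfTraj_two_point`** — under `PLFBounds`, `δ ≥ 0`, `Θ ≤ ρ`, `plfSmall ≤ 1`, for `k ≤ n`:
  `‖Δm_k − Δp‖ ≤ K(δ‖J‖ + 3g)k(k+1)‖Δp‖` and `‖ΔW_k − (kδ)•JΔp‖ ≤ 3gk‖Δp‖` (`g = plfRate`);
* **`plfTraj_fst_approx`** — `‖W_n(p) − W_n(p') − (nδ)•J(p − p')‖ ≤ plfSmall·(nδ‖J‖)·‖p − p'‖`;
  `plfTraj_fst_lipschitz` — `‖W_n(p) − W_n(p')‖ ≤ 2nδ‖J‖‖p − p'‖`.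

In the engine's variables (`G = −½ε∂S` read at `W·U`, `δ = ε`, `τ = nε`): `Θ ≈ ‖ι‖τ(R + τ·sup‖∂S‖)`,
`κ‖J‖ ≈ ½‖ι‖Lip(∂S)τ²` — all SHORT-TRAJECTORY quantities; nothing is asserted when `plfSmall > 1`.
NOT CLAIMED: measure theory, groups, the exponential (next files); floating point.
-/

noncomputable section

namespace Summit.Ventures.LatticeQCDFlow.Exactness

open Set NNReal

variable {𝔸 : Type*} [NormedRing 𝔸] [NormedAlgebra ℝ 𝔸]
variable {V : Type*} [NormedAddCommGroup V] [NormedSpace ℝ V]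

/-! ## §3 Two trajectories: the discrete Grönwall estimate with bilinear defect -/

section Arithmetic

/-- Arithmetic: `k ≥ 0`, `k + 1 ≤ n` ⇒ `k(k+1) ≤ 2n²`. -/
theorem plf_arith_kk {k n : ℝ} (hk0 : 0 ≤ k) (hk : k + 1 ≤ n) : k * (k + 1) ≤ 2 * n ^ 2 := by
  have h1 : k * (k + 1) ≤ (k + 1) * (k + 1) := mul_le_mul_of_nonneg_right (by linarith) (by linarith)
  have h2 : (k + 1) * (k + 1) ≤ n * n := mul_le_mul hk hk (by linarith) (by linarith)
  nlinarith [sq_nonneg n]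

/-- Arithmetic: the smallness number controls its summands. -/
theorem plf_arith_small {Θ C η κJ : ℝ} (hΘ : 0 ≤ Θ) (hC : 1 ≤ C) (hη : 0 ≤ η) (hκ : 0 ≤ κJ)
    (hS : 6 * Θ * (1 + 2 * C) + 6 * η * C + 12 * κJ ≤ 1) : 6 * Θ ≤ 1 ∧ 12 * κJ ≤ 1 := by
  have h1 : 0 ≤ Θ * C := mul_nonneg hΘ (by linarith)
  have h2 : 0 ≤ η * C := mul_nonneg hη (by linarith)
  constructor <;> nlinarith

/-- Arithmetic of the trapping of the momentum error. -/
theorem plf_arith_trap {K dJ g k n : ℝ} (hK : 0 ≤ K) (hdJ : 0 ≤ dJ) (hk0 : 0 ≤ k) (hk : k + 1 ≤ n)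
    (hg3 : 3 * g ≤ dJ) : K * (dJ + 3 * g) * (k * (k + 1)) ≤ 4 * (K * n ^ 2 * dJ) := by
  have hkk := plf_arith_kk hk0 hk
  have h1 : K * (dJ + 3 * g) ≤ K * (2 * dJ) := mul_le_mul_of_nonneg_left (by linarith) hK
  have h2 : K * (dJ + 3 * g) * (k * (k + 1)) ≤ K * (2 * dJ) * (2 * n ^ 2) :=
    mul_le_mul h1 hkk (mul_nonneg hk0 (by linarith)) (by positivity)
  linarith

/-- Arithmetic of the configuration step: the five defect terms fit in the budget `3g = dJ·S`. -/
theorem plf_arith_step {θ S g dJ η C κJ k n N : ℝ} (hθ : 0 ≤ θ) (hdJ : 0 ≤ dJ) (hη : 0 ≤ η) (hC : 0 ≤ C)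
    (hκ : 0 ≤ κJ) (hN : 0 ≤ N) (hn : 0 ≤ n) (hkn : k ≤ n) (hg : 3 * g = dJ * S)
    (hS : S = 6 * (n * θ) * (1 + 2 * C) + 6 * η * C + 12 * κJ) (hS0 : 0 ≤ S) (hS1 : S ≤ 1) :
    3 * g * k * N + 2 * θ * (n * dJ * N + 3 * g * k * N) + η * (dJ * (2 * N)) * C +
        dJ * (2 * N) * (2 * (n * θ) * C) + dJ * (4 * κJ * N) ≤ 3 * g * (k + 1) * N := by
  have p0 : 0 ≤ dJ * S * N := by positivity
  have p1 : k * θ * (dJ * S * N) ≤ n * θ * (dJ * S * N) :=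
    mul_le_mul_of_nonneg_right (mul_le_mul_of_nonneg_right hkn hθ) p0
  have p2 : n * θ * (dJ * S * N) ≤ n * θ * (dJ * 1 * N) := by
    refine mul_le_mul_of_nonneg_left ?_ (mul_nonneg hn hθ)
    exact mul_le_mul_of_nonneg_right (mul_le_mul_of_nonneg_left hS1 hdJ) hN
  have p3 : 3 * g * (θ * k * N) = dJ * S * (θ * k * N) := by rw [hg]
  have p4 : 3 * g * N = dJ * S * N := by rw [hg]
  have p5 : dJ * S * N = dJ * N * (6 * (n * θ) * (1 + 2 * C) + 6 * η * C + 12 * κJ) := by rw [hS]; ring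
  have q1 : 0 ≤ n * θ * dJ * N := by positivity
  have q2 : 0 ≤ n * θ * C * dJ * N := by positivity
  have q3 : 0 ≤ η * C * dJ * N := by positivity
  have q4 : 0 ≤ κJ * dJ * N := by positivity
  linarith [p1, p2, p3, p4, p5, q1, q2, q3, q4]

end Arithmetic

section TwoTrajectories

/-- **The smallness number** `plfSmall = 6Θ(1 + 2C) + 6ηC + 12·(Kδn²‖J‖)`, `Θ = nδ‖J‖(R + (2n+1)b)`
(the total drift angle of an `n`-step trajectory from the momentum ball of radius `R`). -/
def plfSmall (J : V →L[ℝ] 𝔸) (C K η δ b R : ℝ) (n : ℕ) : ℝ :=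
  6 * (n * (δ * ‖J‖ * (R + (2 * n + 1) * b))) * (1 + 2 * C) + 6 * η * C + 12 * (K * δ * (n : ℝ) ^ 2 * ‖J‖)

/-- The per-step rate `g = δ‖J‖·plfSmall/3`. -/
def plfRate (J : V →L[ℝ] 𝔸) (C K η δ b R : ℝ) (n : ℕ) : ℝ := δ * ‖J‖ * plfSmall J C K η δ b R n / 3

omit [NormedAlgebra ℝ 𝔸] in
/-- The algebra of one step of the difference of two trajectories:
`eW − e'W' − (x + y) = (W − W' − x) + (e' − 1)(W − W') + (e − e' − d)W + d(W − 1) + (d − y)`. -/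
theorem plf_step_identity (W W' e e' d x y : 𝔸) :
    e * W - e' * W' - (x + y) = (W - W' - x) + (e' - 1) * (W - W') + (e - e' - d) * W + d * (W - 1) + (d - y) := by
  noncomm_ring

variable {ex : 𝔸 → 𝔸} {J : V →L[ℝ] 𝔸} {G : 𝔸 → V} {T : Set 𝔸} {C b K ρ η : ℝ}
  (h : PLFBounds ex J G T C b K ρ η)
include h

/-- **THE JOINT INDUCTION (discrete Grönwall with bilinear defect).**  Under `PLFBounds`, `δ ≥ 0`,
`‖p‖, ‖p'‖ ≤ R`, `Θ = nδ‖J‖(R + (2n+1)b) ≤ ρ` and `plfSmall ≤ 1`: for every `k ≤ n`,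
`‖Δm_k − Δp‖ ≤ K(δ‖J‖ + 3g)·k(k+1)·‖Δp‖` and `‖ΔW_k − (kδ)•JΔp‖ ≤ 3g·k·‖Δp‖` (`g = plfRate`). -/
theorem plfTraj_two_point {δ : ℝ} (hδ : 0 ≤ δ) {n : ℕ} {R : ℝ} {p p' : V} (hp : ‖p‖ ≤ R) (hp' : ‖p'‖ ≤ R)
    (hρ : n * (δ * ‖J‖ * (R + (2 * n + 1) * b)) ≤ ρ) (hS : plfSmall J C K η δ b R n ≤ 1) :
    ∀ k ≤ n,
      ‖(plfTraj ex J G δ p k).2 - (plfTraj ex J G δ p' k).2 - (p - p')‖ ≤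
          K * (δ * ‖J‖ + 3 * plfRate J C K η δ b R n) * ((k : ℝ) * (k + 1)) * ‖p - p'‖ ∧
      ‖(plfTraj ex J G δ p k).1 - (plfTraj ex J G δ p' k).1 - ((k : ℝ) * δ) • J (p - p')‖ ≤
          3 * plfRate J C K η δ b R n * k * ‖p - p'‖ := by
  -- constants (kept as real atoms; no abbreviation for `Θ = nθ`)
  set θ : ℝ := δ * ‖J‖ * (R + (2 * n + 1) * b) with hθdef
  set S : ℝ := plfSmall J C K η δ b R n with hSdef
  set g : ℝ := plfRate J C K η δ b R n with hgdef
  set N : ℝ := ‖p - p'‖ with hN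
  have hg : g = δ * ‖J‖ * S / 3 := rfl
  have hSexp : S = 6 * (n * θ) * (1 + 2 * C) + 6 * η * C + 12 * (K * δ * (n : ℝ) ^ 2 * ‖J‖) := rfl
  have hK0 : 0 ≤ K := h.lip_nonneg
  have hC1 : 1 ≤ C := h.one_le
  have hC0 : 0 ≤ C := (zero_le_one.trans h.one_le)
  have hη0 : 0 ≤ η := h.defect_nonneg
  have hb0 : 0 ≤ b := h.force_bound_nonneg
  have hJ0 : 0 ≤ ‖J‖ := norm_nonneg _
  have hN0 : 0 ≤ N := norm_nonneg _
  have hn0 : 0 ≤ (n : ℝ) := n.cast_nonneg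
  have hR0 : 0 ≤ R := (norm_nonneg _).trans hp
  have hδJ : 0 ≤ δ * ‖J‖ := mul_nonneg hδ hJ0
  have hθ0 : 0 ≤ θ := by positivity
  have hnθ0 : 0 ≤ n * θ := mul_nonneg hn0 hθ0
  have hκ0 : 0 ≤ K * δ * (n : ℝ) ^ 2 * ‖J‖ := by positivity
  have hS0 : 0 ≤ S := by rw [hSexp]; positivity
  have hg0 : 0 ≤ g := by rw [hg]; positivity
  obtain ⟨hΘ6, hκ12⟩ := plf_arith_small hnθ0 hC1 hη0 hκ0 (hSexp ▸ hS)
  have hg3 : 3 * g ≤ δ * ‖J‖ := by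
    have h1 : δ * ‖J‖ * S ≤ δ * ‖J‖ * 1 := mul_le_mul_of_nonneg_left hS hδJ
    rw [hg]; linarith
  have hgS : 3 * g = δ * ‖J‖ * S := by rw [hg]; ring
  intro k
  induction k with
  | zero =>
    intro _
    constructor
    · have h0 : (plfTraj ex J G δ p 0).2 - (plfTraj ex J G δ p' 0).2 - (p - p') = 0 := by
        simp only [plfTraj_zero]; abel
      rw [h0, norm_zero]; simp
    · simp
  | succ k ih =>
    intro hk
    have hkn : k ≤ n := Nat.le_of_succ_le hk
    have hkn' : (k : ℝ) + 1 ≤ n := by exact_mod_cast hk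
    have hknr : (k : ℝ) ≤ n := Nat.cast_le.2 hkn
    have hk0 : 0 ≤ (k : ℝ) := k.cast_nonneg
    have hn1 : (1 : ℝ) ≤ n := by linarith
    obtain ⟨iha, ihb⟩ := ih hkn
    -- abbreviations
    set W := (plfTraj ex J G δ p k).1 with hW
    set W' := (plfTraj ex J G δ p' k).1 with hW'
    set m := (plfTraj ex J G δ p k).2 with hm
    set m' := (plfTraj ex J G δ p' k).2 with hm'
    set a := δ • J m with ha
    set a' := δ • J m' with ha'
    have hWT : W ∈ T := plfTraj_fst_mem h δ p k
    have hW'T : W' ∈ T := plfTraj_fst_mem h δ p' k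
    have haθ : ‖a‖ ≤ θ := norm_driftArg_le h δ p hp hδ hkn
    have ha'θ : ‖a'‖ ≤ θ := norm_driftArg_le h δ p' hp' hδ hkn
    have hθΘ : θ ≤ n * θ := le_mul_of_one_le_left hθ0 hn1
    have hθρ : θ ≤ ρ := hθΘ.trans hρ
    have haρ : ‖a‖ ≤ ρ := haθ.trans hθρ
    have ha'ρ : ‖a'‖ ≤ ρ := ha'θ.trans hθρ
    -- sizes along one trajectory
    have hWC : ‖W‖ ≤ C := h.norm_le W hWT
    have hW1 : ‖W - 1‖ ≤ 2 * (n * θ) * C := by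
      refine (norm_plfTraj_fst_sub_one_le h δ p hp hδ (n := n) hθρ k hkn).trans ?_
      have h1 : (k : ℝ) * (2 * θ * C) ≤ n * (2 * θ * C) := mul_le_mul_of_nonneg_right hknr (by positivity)
      linarith
    -- differences: momenta, drift arguments, configurations
    have hea : ‖m - m' - (p - p')‖ ≤ 4 * (K * δ * (n : ℝ) ^ 2 * ‖J‖) * N := by
      refine iha.trans ?_
      have h1 := plf_arith_trap (g := g) hK0 hδJ hk0 hkn' hg3
      have h2 : K * (δ * ‖J‖ + 3 * g) * ((k : ℝ) * (k + 1)) * N ≤ 4 * (K * (n : ℝ) ^ 2 * (δ * ‖J‖)) * N :=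
        mul_le_mul_of_nonneg_right h1 hN0
      refine h2.trans (le_of_eq ?_); ring
    have hea1 : ‖m - m' - (p - p')‖ ≤ N := by
      refine hea.trans ?_
      have h1 : 4 * (K * δ * (n : ℝ) ^ 2 * ‖J‖) * N ≤ 1 * N := mul_le_mul_of_nonneg_right (by linarith) hN0
      linarith
    have hΔm : ‖m - m'‖ ≤ 2 * N := by
      calc ‖m - m'‖ = ‖(m - m' - (p - p')) + (p - p')‖ := by rw [sub_add_cancel]
        _ ≤ ‖m - m' - (p - p')‖ + N := norm_add_le _ _
        _ ≤ 2 * N := by linarith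
    have hΔa : ‖a - a'‖ ≤ δ * ‖J‖ * (2 * N) := by
      rw [ha, ha', ← smul_sub, ← map_sub, norm_smul, Real.norm_of_nonneg hδ, mul_assoc]
      exact mul_le_mul_of_nonneg_left ((J.le_opNorm _).trans (mul_le_mul_of_nonneg_left hΔm hJ0)) hδ
    have hΔa' : ‖a - a' - δ • J (p - p')‖ ≤ δ * ‖J‖ * (4 * (K * δ * (n : ℝ) ^ 2 * ‖J‖) * N) := by
      rw [ha, ha', ← smul_sub, ← map_sub, ← smul_sub, ← map_sub, norm_smul, Real.norm_of_nonneg hδ, mul_assoc]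
      exact mul_le_mul_of_nonneg_left ((J.le_opNorm _).trans (mul_le_mul_of_nonneg_left hea hJ0)) hδ
    have hΔW : ‖W - W'‖ ≤ n * (δ * ‖J‖) * N + 3 * g * k * N := by
      calc ‖W - W'‖ = ‖(W - W' - ((k : ℝ) * δ) • J (p - p')) + ((k : ℝ) * δ) • J (p - p')‖ := by rw [sub_add_cancel]
        _ ≤ ‖W - W' - ((k : ℝ) * δ) • J (p - p')‖ + ‖((k : ℝ) * δ) • J (p - p')‖ := norm_add_le _ _
        _ ≤ 3 * g * k * N + k * (δ * (‖J‖ * N)) := by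
            refine add_le_add ihb ?_
            rw [norm_smul, Real.norm_of_nonneg (mul_nonneg hk0 hδ), mul_assoc]
            exact mul_le_mul_of_nonneg_left (mul_le_mul_of_nonneg_left (J.le_opNorm _) hδ) hk0
        _ ≤ n * (δ * ‖J‖) * N + 3 * g * k * N := by
            have h1 : (k : ℝ) * (δ * (‖J‖ * N)) ≤ n * (δ * (‖J‖ * N)) :=
              mul_le_mul_of_nonneg_right hknr (by positivity)
            linarith
    -- (b_{k+1}): the configuration estimate
    have hWs : (plfTraj ex J G δ p (k + 1)).1 = ex a * W := plfTraj_succ_fst ex J G δ p k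
    have hWs' : (plfTraj ex J G δ p' (k + 1)).1 = ex a' * W' := plfTraj_succ_fst ex J G δ p' k
    have hb : ‖(plfTraj ex J G δ p (k + 1)).1 - (plfTraj ex J G δ p' (k + 1)).1 -
        (((↑(k + 1) : ℝ)) * δ) • J (p - p')‖ ≤ 3 * g * (↑(k + 1) : ℝ) * N := by
      have hsplit : (((↑(k + 1) : ℝ)) * δ) • J (p - p') = ((k : ℝ) * δ) • J (p - p') + δ • J (p - p') := by
        push_cast; rw [add_mul, one_mul, add_smul]
      rw [hWs, hWs', hsplit, plf_step_identity W W' (ex a) (ex a') (a - a') (((k : ℝ) * δ) • J (p - p')) (δ • J (p - p'))]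
      have t1 : ‖(ex a' - 1) * (W - W')‖ ≤ 2 * θ * (n * (δ * ‖J‖) * N + 3 * g * k * N) :=
        (norm_mul_le _ _).trans (mul_le_mul ((h.norm_ex_sub_one_le ha'ρ).trans (by linarith)) hΔW
          (norm_nonneg _) (by positivity))
      have t2 : ‖(ex a - ex a' - (a - a')) * W‖ ≤ η * (δ * ‖J‖ * (2 * N)) * C :=
        (norm_mul_le _ _).trans (mul_le_mul ((h.ex_defect a a' haρ ha'ρ).trans
          (mul_le_mul_of_nonneg_left hΔa hη0)) hWC (norm_nonneg _) (by positivity))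
      have t3 : ‖(a - a') * (W - 1)‖ ≤ δ * ‖J‖ * (2 * N) * (2 * (n * θ) * C) :=
        (norm_mul_le _ _).trans (mul_le_mul hΔa hW1 (norm_nonneg _) (by positivity))
      have harith := plf_arith_step (g := g) (κJ := K * δ * (n : ℝ) ^ 2 * ‖J‖) hθ0 hδJ hη0 hC0 hκ0 hN0 hn0
        hknr hgS hSexp hS0 hS
      calc ‖W - W' - ((k : ℝ) * δ) • J (p - p') + (ex a' - 1) * (W - W') + (ex a - ex a' - (a - a')) * W +
            (a - a') * (W - 1) + (a - a' - δ • J (p - p'))‖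
          ≤ ‖W - W' - ((k : ℝ) * δ) • J (p - p')‖ + ‖(ex a' - 1) * (W - W')‖ + ‖(ex a - ex a' - (a - a')) * W‖ +
            ‖(a - a') * (W - 1)‖ + ‖a - a' - δ • J (p - p')‖ :=
            (norm_add_le _ _).trans (add_le_add ((norm_add_le _ _).trans (add_le_add
              ((norm_add_le _ _).trans (add_le_add (norm_add_le _ _) le_rfl)) le_rfl)) le_rfl)
        _ ≤ 3 * g * k * N + 2 * θ * (n * (δ * ‖J‖) * N + 3 * g * k * N) + η * (δ * ‖J‖ * (2 * N)) * C +
            δ * ‖J‖ * (2 * N) * (2 * (n * θ) * C) + δ * ‖J‖ * (4 * (K * δ * (n : ℝ) ^ 2 * ‖J‖) * N) :=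
            add_le_add (add_le_add (add_le_add (add_le_add ihb t1) t2) t3) hΔa'
        _ ≤ 3 * g * (↑(k + 1) : ℝ) * N := by push_cast; linarith
    refine ⟨?_, hb⟩
    -- (a_{k+1}): the momentum estimate
    have hms : (plfTraj ex J G δ p (k + 1)).2 = m + (2 : ℝ) • G (plfTraj ex J G δ p (k + 1)).1 := plfTraj_succ_snd ex J G δ p k
    have hms' : (plfTraj ex J G δ p' (k + 1)).2 = m' + (2 : ℝ) • G (plfTraj ex J G δ p' (k + 1)).1 := plfTraj_succ_snd ex J G δ p' k
    have hk1 : 0 ≤ (↑(k + 1) : ℝ) * δ := mul_nonneg (Nat.cast_nonneg _) hδ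
    have hWk1 : ‖(plfTraj ex J G δ p (k + 1)).1 - (plfTraj ex J G δ p' (k + 1)).1‖ ≤
        (↑(k + 1) : ℝ) * δ * (‖J‖ * N) + 3 * g * (↑(k + 1) : ℝ) * N := by
      calc ‖(plfTraj ex J G δ p (k + 1)).1 - (plfTraj ex J G δ p' (k + 1)).1‖
          = ‖((plfTraj ex J G δ p (k + 1)).1 - (plfTraj ex J G δ p' (k + 1)).1 - (((↑(k + 1) : ℝ)) * δ) • J (p - p')) +
              (((↑(k + 1) : ℝ)) * δ) • J (p - p')‖ := by rw [sub_add_cancel]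
        _ ≤ 3 * g * (↑(k + 1) : ℝ) * N + ‖(((↑(k + 1) : ℝ)) * δ) • J (p - p')‖ := (norm_add_le _ _).trans (add_le_add hb le_rfl)
        _ ≤ 3 * g * (↑(k + 1) : ℝ) * N + (↑(k + 1) : ℝ) * δ * (‖J‖ * N) := by
            refine add_le_add le_rfl ?_
            rw [norm_smul, Real.norm_of_nonneg hk1]
            exact mul_le_mul_of_nonneg_left (J.le_opNorm _) hk1
        _ = (↑(k + 1) : ℝ) * δ * (‖J‖ * N) + 3 * g * (↑(k + 1) : ℝ) * N := by ring
    have hG2 : ‖(2 : ℝ) • G (plfTraj ex J G δ p (k + 1)).1 - (2 : ℝ) • G (plfTraj ex J G δ p' (k + 1)).1‖ ≤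
        2 * (K * ((↑(k + 1) : ℝ) * δ * (‖J‖ * N) + 3 * g * (↑(k + 1) : ℝ) * N)) := by
      rw [← smul_sub, norm_smul, Real.norm_two]
      exact mul_le_mul_of_nonneg_left ((h.force_lip _ (plfTraj_fst_mem h δ p (k + 1)) _ (plfTraj_fst_mem h δ p' (k + 1))).trans
        (mul_le_mul_of_nonneg_left hWk1 hK0)) zero_le_two
    have hsplit : (plfTraj ex J G δ p (k + 1)).2 - (plfTraj ex J G δ p' (k + 1)).2 - (p - p') =
        (m - m' - (p - p')) + ((2 : ℝ) • G (plfTraj ex J G δ p (k + 1)).1 - (2 : ℝ) • G (plfTraj ex J G δ p' (k + 1)).1) := by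
      rw [hms, hms']; abel
    rw [hsplit]
    calc ‖(m - m' - (p - p')) + ((2 : ℝ) • G (plfTraj ex J G δ p (k + 1)).1 - (2 : ℝ) • G (plfTraj ex J G δ p' (k + 1)).1)‖
        ≤ ‖m - m' - (p - p')‖ + ‖(2 : ℝ) • G (plfTraj ex J G δ p (k + 1)).1 - (2 : ℝ) • G (plfTraj ex J G δ p' (k + 1)).1‖ :=
          norm_add_le _ _
      _ ≤ K * (δ * ‖J‖ + 3 * g) * ((k : ℝ) * (k + 1)) * N + 2 * (K * ((↑(k + 1) : ℝ) * δ * (‖J‖ * N) + 3 * g * (↑(k + 1) : ℝ) * N)) :=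
          add_le_add iha hG2
      _ = K * (δ * ‖J‖ + 3 * g) * ((↑(k + 1) : ℝ) * ((↑(k + 1) : ℝ) + 1)) * N := by push_cast; ring

/-- **THE `n`-STEP PRODUCT IS A LIPSCHITZ-SMALL PERTURBATION OF `p ↦ W_n(0) + nδ·Jp` ON THE MOMENTUM
BALL**: `‖W_n(p) − W_n(p') − (nδ)•J(p − p')‖ ≤ plfSmall · (nδ‖J‖) · ‖p − p'‖`. -/
theorem plfTraj_fst_approx {δ : ℝ} (hδ : 0 ≤ δ) {n : ℕ} {R : ℝ} {p p' : V} (hp : ‖p‖ ≤ R) (hp' : ‖p'‖ ≤ R)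
    (hρ : n * (δ * ‖J‖ * (R + (2 * n + 1) * b)) ≤ ρ) (hS : plfSmall J C K η δ b R n ≤ 1) :
    ‖(plfTraj ex J G δ p n).1 - (plfTraj ex J G δ p' n).1 - ((n : ℝ) * δ) • J (p - p')‖ ≤
      plfSmall J C K η δ b R n * ((n : ℝ) * δ * ‖J‖) * ‖p - p'‖ := by
  refine ((plfTraj_two_point h hδ hp hp' hρ hS n le_rfl).2).trans (le_of_eq ?_)
  simp only [plfRate]
  ring

/-- **Upper Lipschitz bound**: `‖W_n(p) − W_n(p')‖ ≤ 2nδ‖J‖·‖p − p'‖` (as `plfSmall ≤ 1`). -/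
theorem plfTraj_fst_lipschitz {δ : ℝ} (hδ : 0 ≤ δ) {n : ℕ} {R : ℝ} {p p' : V} (hp : ‖p‖ ≤ R) (hp' : ‖p'‖ ≤ R)
    (hρ : n * (δ * ‖J‖ * (R + (2 * n + 1) * b)) ≤ ρ) (hS : plfSmall J C K η δ b R n ≤ 1) :
    ‖(plfTraj ex J G δ p n).1 - (plfTraj ex J G δ p' n).1‖ ≤ 2 * ((n : ℝ) * δ * ‖J‖) * ‖p - p'‖ := by
  have h1 := plfTraj_fst_approx h hδ hp hp' hρ hS
  have hτ : 0 ≤ (n : ℝ) * δ := mul_nonneg n.cast_nonneg hδ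
  have h2 : plfSmall J C K η δ b R n * ((n : ℝ) * δ * ‖J‖) * ‖p - p'‖ ≤ 1 * ((n : ℝ) * δ * ‖J‖) * ‖p - p'‖ :=
    mul_le_mul_of_nonneg_right (mul_le_mul_of_nonneg_right hS (mul_nonneg hτ (norm_nonneg _))) (norm_nonneg _)
  calc ‖(plfTraj ex J G δ p n).1 - (plfTraj ex J G δ p' n).1‖
      = ‖((plfTraj ex J G δ p n).1 - (plfTraj ex J G δ p' n).1 - ((n : ℝ) * δ) • J (p - p')) + ((n : ℝ) * δ) • J (p - p')‖ := by
        rw [sub_add_cancel]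
    _ ≤ plfSmall J C K η δ b R n * ((n : ℝ) * δ * ‖J‖) * ‖p - p'‖ + ‖((n : ℝ) * δ) • J (p - p')‖ := (norm_add_le _ _).trans (add_le_add h1 le_rfl)
    _ ≤ 1 * ((n : ℝ) * δ * ‖J‖) * ‖p - p'‖ + (n : ℝ) * δ * (‖J‖ * ‖p - p'‖) := by
        refine add_le_add h2 ?_
        rw [norm_smul, Real.norm_of_nonneg hτ]
        exact mul_le_mul_of_nonneg_left (J.le_opNorm _) hτ
    _ = 2 * ((n : ℝ) * δ * ‖J‖) * ‖p - p'‖ := by ring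

end TwoTrajectories

end Summit.Ventures.LatticeQCDFlow.Exactness
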